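import Summits.FinalStateConjecture.FinalStateConjecture.Theorems.ZeroEnergyKerrOrBombStationaryLimitReductionDualModeEjectionWave3
import Summits.FinalStateConjecture.FinalStateConjecture.Theorems.ZeroEnergyKerrOrBombStationaryLimitReductionMoncriefFactsWave3
import Summits.FinalStateConjecture.FinalStateConjecture.Theorems.ZeroEnergyKerrOrBombStationaryLimitReductionMoncriefDualityReductionWave3
import Literature.Geometry.Lorentzian.TameGenericity
import HarnessLib

/-!
# Route ZeroEnergyKerrOrBomb · crux `FinalStateFromKerrOrBomb` (stmt-FinalStateConjecture-17839), line
# `SketchIdeator1` — stub `stub_dualModeEjectionModT` (5′): VACUITY AUDIT of the ModT/T2 re-typing, kernel certificates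

Helper file (`--supports stmt-FinalStateConjecture-17839`) of the wave-1 stub worker for
`stub_dualModeEjectionModT : SigM.stub_dualModeEjectionModT` (lead prover-line-stmt-FinalStateConjecture-17839-0,
2026-08-17). The stub is r7's `Sig7.stub_dualModeEjection` with `InTelescopeModT (d.hole i)` among the per-hole
hypotheses and `SettlesDocWithT2 ModeStableModT` as the settling currency of the conclusion; its detector clause
`AreSymmDetectorsAt 𝒟 x₀ A B` and its steering clause (`∀ G, … → (pairingMatrix D x₀ A B G).det ≠ 0 → ∃ ε F, …`,
now with an IMMERSED sub-curve and a `‖c‖ < ε` window) are unchanged from r4/r7 up to those two points. The stub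
is open as mathematics (dual-mode transport, local non-gauge-ness of the dual mode, the saddle, the fate of the
explosion; no MGHD is constructible in this tree). What this file decides is whether the re-typing re-opened a
JUNK door of the steering clause. It did not:

* §1 `areSymmDetectorsAt_fin0_iff`: with `k = 0` the detector clause holds at EVERY germ-KID-free point (it is
  `IsKIDFreeAt 𝒟 x₀` on the nose) — so the `∃ x₀ k A B, AreSymmDetectorsAt …` prefix is free for `k = 0`;
* §2 but the `k = 0` steering clause is UNSATISFIABLE in the re-typed shape, whatever the settling predicate: the
  constant family is an admissible `0`-parameter family through `D` supported in `∅` with `det = 1`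
  (`Matrix.det_isEmpty`), and a curve inside a single datum is constant, hence NOT immersed at `0`
  (`not_isImmersedAtZero_of_forall_mem_range_fin0`, via the tree's `not_isImmersedAtZero_const`) and not injective
  on any norm window (`not_injOn_normBall_of_forall_mem_range_fin0`, the `‖c‖` form of p104819's `|c 0|` lemma);
  `steering_fin0_false` packages this for an ARBITRARY settling predicate `P`. Hence every proof of 5′ must produce
  `k ≥ 1` symmetric detectors, for which the non-gauge clause of `AreDetectorsAt` is a genuine obligation: the zero
  pair and every pair vanishing near `x₀` ARE local slice tangents (`isLocalSliceTangentAt_zero` p115964,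
  `isLocalSliceTangentAt_of_eventuallyEq_zero` of `…DualModeEjectionWave3`), antisymmetric detectors are excluded by the symmetry
  conjunct, far-away junk of the detectors is invisible to the pairing (`chartPairing_congr_on_kick_support`);
* §3 `steering_nonvacuous_of_moncriefResiduals`: for ANY detectors satisfying `AreSymmDetectorsAt 𝒟 x₀ A B` at an
  admissible datum, the two residual facts of the neighbour stub 4 in their r7 shape (the cited Literature fact
  `ChruscielDelay_localConstraintDeformation` ∧ local single detection `LocalSingleDetectionAt` at every point)
  PRODUCE a jointly smooth admissible family through `D`, supported in a compact subset of the chart source at `x₀`,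
  with `det ≠ 0` — so the steering clause of 5′ is never vacuous for an admissible choice of detectors unless stub 4
  fails: `vacuous_steering_refutes_moncriefResiduals` (a junk proof of 5′ by vacuity would be a DISPROOF of
  `Sig7.stub_moncriefResiduals`, whose body is spelled verbatim here since the Sig7 module is not yet built).

No new definitions, no named facts asserted (they appear only as explicit hypotheses), no `sorry`, no new axioms.
-/

-- every `Summit.FinalStateConjecture.FinalStateConjecture.…` name repeats the summit = sub-problem segment (D-0017 layout)
set_option linter.dupNamespace false
set_option maxSynthPendingDepth 3

noncomputable section

open scoped Manifold ContDiff Topology BigOperators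
open Set Filter Bundle MeasureTheory Literature.Geometry.Lorentzian

namespace Summit.FinalStateConjecture.FinalStateConjecture.Theorems.SymplecticDualOfTheBomb

open Summit.FinalStateConjecture.FinalStateConjecture.Theorems.OneLockedExplosion

/-! ## §1 `k = 0`: the detector clause is free at every germ-KID-free point -/

/-- **With no detector, `AreSymmDetectorsAt` is exactly germ-KID-freeness of `x₀`**: the symmetry, smoothness
and non-gauge clauses quantify over `Fin 0` (resp. over coefficient vectors `a : Fin 0 → ℝ`, all equal to `0`),
and `HasNoLocalKillingFieldNear` follows from `IsKIDFreeAt` (`hasNoLocalKillingFieldNear_of_isKIDFreeAt`). So the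
`∃ x₀ k A B, AreSymmDetectorsAt 𝒟 x₀ A B` prefix of stub 5′ is free for `k = 0` under its hypothesis
`∃ x, IsKIDFreeAt 𝒟 x`; the content is in the steering clause (§2). [folklore] -/
theorem areSymmDetectorsAt_fin0_iff : ∀ (X : Type) [TopologicalSpace X] [ChartedSpace E3 X] [IsManifold (𝓡 3) ∞ X] [T2Space X] [SecondCountableTopology X] [ConnectedSpace X] {D : InitialDataSet (𝓡 3) X} (𝒟 : VacuumCauchyDevelopment D) (x₀ : X) (A B : Fin 0 → BilinField X), AreSymmDetectorsAt 𝒟 x₀ A B ↔ IsKIDFreeAt 𝒟 x₀ := by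
  intro X _ _ _ _ _ _ D 𝒟 x₀ A B
  refine ⟨fun h ↦ h.2.1, fun h ↦ ⟨fun j ↦ j.elim0, h, hasNoLocalKillingFieldNear_of_isKIDFreeAt X 𝒟 x₀ h,
    ⟨Set.univ, isOpen_univ, Set.mem_univ _, fun j ↦ j.elim0⟩, fun a ha ↦ absurd (Subsingleton.elim a 0) ha⟩⟩

/-! ## §2 `k = 0`: the re-typed steering clause is unsatisfiable (immersion, norm window) -/

/-- **A curve inside a `0`-parameter family is not immersed at `0`**: its members all equal the single datum
`G 0`, so it is a constant family, and constant families are not immersed (`not_isImmersedAtZero_const`: every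
parameter derivative of every component vanishes). [folklore] -/
theorem not_isImmersedAtZero_of_forall_mem_range_fin0 : ∀ (X : Type) [TopologicalSpace X] [ChartedSpace E3 X] [IsManifold (𝓡 3) ∞ X] (F : EuclideanSpace ℝ (Fin 1) → InitialDataSet (𝓡 3) X) (G : EuclideanSpace ℝ (Fin 0) → InitialDataSet (𝓡 3) X), (∀ c, ∃ c', F c = G c') → ¬ InitialDataSet.IsImmersedAtZero 1 F := by
  intro X _ _ _ F G hFG
  have hF : F = fun _ ↦ G 0 := funext fun c ↦ by
    obtain ⟨c', hc'⟩ := hFG c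
    rw [hc', Subsingleton.elim c' 0]
  rw [hF]
  exact InitialDataSet.not_isImmersedAtZero_const one_ne_zero _

/-- **A curve inside a `0`-parameter family is not injective on any norm window** `‖c‖ < ε`, `ε > 0` (the
`‖c‖` form, used by the re-typed stub, of p104819's `not_injOn_ball_of_forall_mem_range_fin0`): `0` and
`(ε/2) e₀` are distinct parameters in the window with the same (constant) member. [folklore] -/
theorem not_injOn_normBall_of_forall_mem_range_fin0 : ∀ (X : Type) [TopologicalSpace X] [ChartedSpace E3 X] [IsManifold (𝓡 3) ∞ X] (ε : ℝ) (F : EuclideanSpace ℝ (Fin 1) → InitialDataSet (𝓡 3) X) (G : EuclideanSpace ℝ (Fin 0) → InitialDataSet (𝓡 3) X), 0 < ε → (∀ c, ∃ c', F c = G c') → ¬ (∀ c c' : EuclideanSpace ℝ (Fin 1), ‖c‖ < ε → ‖c'‖ < ε → F c = F c' → c = c') := by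
  intro X _ _ _ ε F G hε hFG hinj
  have hF : ∀ c, F c = G 0 := fun c ↦ by
    obtain ⟨c', hc'⟩ := hFG c
    rw [hc', Subsingleton.elim c' 0]
  have h0 : ‖(0 : EuclideanSpace ℝ (Fin 1))‖ < ε := by simp [hε]
  have h1 : ‖(EuclideanSpace.single (0 : Fin 1) (ε / 2))‖ < ε := by
    have key : |ε| / 2 < ε := by
      rw [abs_of_pos hε]
      exact half_lt_self hε
    simpa using key
  have h2 := congrArg (fun c : EuclideanSpace ℝ (Fin 1) ↦ c 0)
    (hinj 0 _ h0 h1 ((hF 0).trans (hF _).symm))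
  simp at h2
  linarith

/-- **The `k = 0` branch of the re-typed steering clause is unsatisfiable, whatever the settling predicate `P`.**
For an admissible `D`, any `x₀` and the empty detector families, the clause "every jointly smooth admissible
`0`-family `G` through `D` supported in a compact subset of the chart source with `det ≠ 0` contains an immersed,
window-injective sub-curve whose small non-zero members satisfy `P`" FAILS: the constant family meets every
antecedent (`isSmoothDataFamily_const`, `K = ∅`, `Matrix.det_isEmpty`), and no curve inside it is immersed at `0`
(`not_isImmersedAtZero_of_forall_mem_range_fin0`). With §1: every proof of stub 5′ must exhibit `k ≥ 1` SYMMETRIC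
detectors and certify their non-gauge clause. [folklore] -/
theorem steering_fin0_false : ∀ (X : Type) [TopologicalSpace X] [ChartedSpace E3 X] [IsManifold (𝓡 3) ∞ X] (P : InitialDataSet (𝓡 3) X → Prop), ∀ D ∈ admissibleVacuumData X, ∀ (x₀ : X) (A B : Fin 0 → BilinField X), ¬ (∀ G : EuclideanSpace ℝ (Fin 0) → InitialDataSet (𝓡 3) X, InitialDataSet.IsSmoothDataFamily 0 G → G 0 = D → (∀ c, G c ∈ admissibleVacuumData X) → (∃ K : Set X, IsCompact K ∧ K ⊆ (extChartAt (𝓡 3) x₀).source ∧ IsSupportedIn D G K) → (pairingMatrix D x₀ A B G).det ≠ 0 → ∃ (ε : ℝ) (F : EuclideanSpace ℝ (Fin 1) → InitialDataSet (𝓡 3) X), 0 < ε ∧ InitialDataSet.IsSmoothDataFamily 1 F ∧ InitialDataSet.IsImmersedAtZero 1 F ∧ F 0 = D ∧ (∀ c, ∃ c', F c = G c') ∧ (∀ c c' : EuclideanSpace ℝ (Fin 1), ‖c‖ < ε → ‖c'‖ < ε → F c = F c' → c = c') ∧ ∀ c : EuclideanSpace ℝ (Fin 1), c ≠ 0 →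 ‖c‖ < ε → P (F c)) := by
  intro X _ _ _ P D hD x₀ A B h
  have hdet : (pairingMatrix D x₀ A B (fun _ : EuclideanSpace ℝ (Fin 0) ↦ D)).det ≠ 0 := by
    rw [Matrix.det_isEmpty]
    exact one_ne_zero
  obtain ⟨ε, F, -, -, himm, -, hFG, -, -⟩ := h (fun _ ↦ D) (InitialDataSet.isSmoothDataFamily_const 0 D) rfl
    (fun _ ↦ hD) ⟨∅, isCompact_empty, Set.empty_subset _, fun _ _ _ ↦ ⟨rfl, rfl⟩⟩ hdet
  exact not_isImmersedAtZero_of_forall_mem_range_fin0 X F _ hFG himm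

/-! ## §3 `k ≥ 1`: the steering clause is non-vacuous for every admissible choice of detectors, unless stub 4 fails -/

/-- **Transversal families exist for every admissible choice of detectors, given the two residual facts of stub 4
(r7 shape).** If the cited Literature fact `ChruscielDelay_localConstraintDeformation` holds and local single
detection `LocalSingleDetectionAt` holds at every point of every vacuum development (the body of
`Sig7.stub_moncriefResiduals`, spelled), then for every admissible `D`, every `𝒟`, and EVERY `(x₀, k, A, B)` with
`AreSymmDetectorsAt 𝒟 x₀ A B` there is a jointly smooth admissible `k`-family through `D`, supported in a compact
subset of the chart source at `x₀`, with non-singular pairing matrix — the landed lever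
`stub_moncriefTransversality_of_localDeformation` (p105738) fed through `localConstraintDeformationAt_of_fact` and
`localMoncriefDuality_of_singleDetection` (p124601/p124620) at `V := univ`. So the `∀ G, … det ≠ 0 → …` clause
of stub 5′ always has an instance. [cite: Wald1984GR, Appendix E.2] -/
theorem steering_nonvacuous_of_moncriefResiduals : (Literature.Geometry.Lorentzian.ChruscielDelay_localConstraintDeformation ∧ ∀ (X : Type) [TopologicalSpace X] [ChartedSpace E3 X] [IsManifold (𝓡 3) ∞ X] [T2Space X] [SecondCountableTopology X] [ConnectedSpace X] (D : InitialDataSet (𝓡 3) X) (𝒟 : VacuumCauchyDevelopment D) (x₀ : X), LocalSingleDetectionAt 𝒟 x₀) → ∀ (X : Type) [TopologicalSpace X] [ChartedSpace E3 X] [IsManifold (𝓡 3) ∞ X] [T2Space X] [SecondCountableTopology X] [ConnectedSpace X], ∀ D ∈ admissibleVacuumData X, ∀ (𝒟 : VacuumCauchyDevelopment D) (x₀ : X) (k : ℕ) (A B : Fin k → BilinField X), AreSymmDetectorsAt 𝒟 x₀ A B → ∃ G : EuclideanSpace ℝ (Fin k) → InitialDataSet (𝓡 3) X, InitialDataSet.IsSmoothDataFamily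 k G ∧ G 0 = D ∧ (∀ c, G c ∈ admissibleVacuumData X) ∧ (∃ K : Set X, IsCompact K ∧ K ⊆ (extChartAt (𝓡 3) x₀).source ∧ IsSupportedIn D G K) ∧ (pairingMatrix D x₀ A B G).det ≠ 0 := by
  rintro ⟨hCD, hSD⟩ X _ _ _ _ _ _ D hD 𝒟 x₀ k A B hdet
  obtain ⟨G, hG, hG0, hGadm, ⟨K, hKc, -, hKsrc, hsupp⟩, hdetG⟩ :=
    stub_moncriefTransversality_of_localDeformation X D hD 𝒟 x₀ k A B hdet.2.2 hdet.1 hdet.2.1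
      (localConstraintDeformationAt_of_fact hCD X D 𝒟 x₀)
      (localMoncriefDuality_of_singleDetection X D 𝒟 x₀ (hSD X D 𝒟 x₀)) Set.univ isOpen_univ (Set.mem_univ _)
  exact ⟨G, hG, hG0, hGadm, ⟨K, hKc, hKsrc, hsupp⟩, hdetG⟩

/-- **A junk proof of stub 5′ by vacuity would refute stub 4.** If at ONE admissible datum some detectors
satisfying `AreSymmDetectorsAt 𝒟 x₀ A B` make the steering clause vacuous — every jointly smooth admissible
`k`-family through `D` supported in a compact subset of the chart source at `x₀` has SINGULAR pairing matrix —
then the conjunction of the two residual facts of stub 4 (cited Chruściel–Delay deformation fact ∧ local single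
detection everywhere) is false. Contrapositive of `steering_nonvacuous_of_moncriefResiduals`. [folklore] -/
theorem vacuous_steering_refutes_moncriefResiduals : (∃ (X : Type) (_ : TopologicalSpace X) (_ : ChartedSpace E3 X) (_ : IsManifold (𝓡 3) ∞ X) (_ : T2Space X) (_ : SecondCountableTopology X) (_ : ConnectedSpace X) (D : InitialDataSet (𝓡 3) X) (_ : D ∈ admissibleVacuumData X) (𝒟 : VacuumCauchyDevelopment D) (x₀ : X) (k : ℕ) (A B : Fin k → BilinField X), AreSymmDetectorsAt 𝒟 x₀ A B ∧ ∀ G : EuclideanSpace ℝ (Fin k) → InitialDataSet (𝓡 3) X, InitialDataSet.IsSmoothDataFamily k G → G 0 = D → (∀ c, G c ∈ admissibleVacuumData X) → (∃ K : Set X, IsCompact K ∧ K ⊆ (extChartAt (𝓡 3) x₀).source ∧ IsSupportedIn D G K) → (pairingMatrix D x₀ A B G).det = 0) → ¬ (Literature.Geometry.Lorentzian.ChruscielDelay_localConstraintDeformation ∧ ∀ (X : Type) [TopologicalSpace X] [ChartedSpace E3 X] [IsManifold (𝓡 3) ∞ X] [T2Space X] [SecondCountableTopology X] [ConnectedSpace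 X] (D : InitialDataSet (𝓡 3) X) (𝒟 : VacuumCauchyDevelopment D) (x₀ : X), LocalSingleDetectionAt 𝒟 x₀) := by
  rintro ⟨X, _, _, _, _, _, _, D, hD, 𝒟, x₀, k, A, B, hdet, hvac⟩ hM
  obtain ⟨G, hG, hG0, hGadm, hGK, hdetG⟩ := steering_nonvacuous_of_moncriefResiduals hM X D hD 𝒟 x₀ k A B hdet
  exact hdetG (hvac G hG hG0 hGadm hGK)

end Summit.FinalStateConjecture.FinalStateConjecture.Theorems.SymplecticDualOfTheBomb

end
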